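/-
Copyright (c) 2026 the pub-hodgecm-mathlib formalisation cell (harness21).  Prover seat hodgecm-mathlib-K2E1-p14 (g2) (R90-TF S8 «U(Φ₃) χ-TWIN», TWIN-DAG row 7b feeder (C),
R90-CS-plan (g2) S8-R19), Track B «K2-LIT» ENGINE E1, h413 = `stmt-HodgeConjecture-24833`, route `HCCMUnconditional`: the Fubini and continuity letters of ★
`chi_symbol_symm_of_selfDual_three` discharged at the CM pair `U(2,1)_{L∕L⁺}` — `s(z) = s(2 − z)` for a self-dual pair modulo ONE non-vanishing letter; the N = 3 twin of ★
`K2E1ChiSymbolWeylSymmetrySelfDualCMTwo`.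
-/
import Summits.HodgeConjecture.HodgeConjecture.Theorems.K2E1ChiSymbolWeylSymmetrySelfDualU3      -- ★ (C) FILE 1 (this seat): `chi_symbol_symm_of_selfDual_three` (letters `hint hcontM hMne` on `{Re w > 2}`)
import Summits.HodgeConjecture.HodgeConjecture.Theorems.K2E1ChiSymbolWeylSymmetrySelfDualCMTwo  -- ★ (K2E2-p12): §1 EVERY RANK `integrable_mul_flatSectionU_prod_of_scaling` (reused BY NAME, not copied)
import Summits.HodgeConjecture.HodgeConjecture.Theorems.K2E1IntertwinedCoeffContinuousCM       -- ★ `integrable_borelHeight_weylLongU_mul_rpow_cm_three` (the `hintw` payer on `{Re w > 2}`)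
import Summits.HodgeConjecture.HodgeConjecture.Theorems.K2E1MaassSelbergSphericalBracketsCMThree -- ★ N = 3 `integral_borelHeight_weylLongU_mul_cpow_eq` (the scaling identity, `H(g)^{2−w}`)
import HarnessLib

/-!
# S8 «U(Φ₃) χ-TWIN» — `K2E1ChiSymbolWeylSymmetrySelfDualCMThree` ((C) FILE 2): THE FUBINI LETTER `hint` AND THE CONTINUITY LETTER `hcontM` OF ★ `chi_symbol_symm_of_selfDual_three`
# DISCHARGED AT THE CM PAIR `U(2,1)_{L∕L⁺}` ON `{Re w > 2}` — `s(z) = s(2 − z)` for a SELF-DUAL pair `(χ₁, χ₂)` modulo ONE letter: the intertwined section `M(w₁)φ` is non-zero at ONE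
# point for ONE `Re w₁ > 2` (the N = 3 twin of ★ `K2E1ChiSymbolWeylSymmetrySelfDualCMTwo`; `ρ₀ : 1 ↦ 2`, `½ ± it ↦ 1 ± it`)

Track B ∕ K2-LIT, crux h413 = `stmt-HodgeConjecture-24833`, route of record `HCCMUnconditional`; cell `hodgecm-mathlib`, R90-TF slab S8 (TWIN-DAG v1 of K2E1-p16 (g2), row 7b feeder (C) of
`K2E1ChiConvDataLevelCMThree`).  THEOREMS ONLY (no `def`, no `instance`, no notation, no named-fact hypothesis, no `sorry`; default heartbeats); lane
`--supports stmt-HodgeConjecture-24833 --as helper` (count-neutral).  CLOSES NO SOCKET.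

THE MATHEMATICS ([MoeglinWaldspurger1995, II.1.6–II.1.7, IV.1.10]; [Garrett2018, §2.8]; [Rogawski1990, §13.9]).  ★ `chi_symbol_symm_of_selfDual_three` (every quasi-split `(F, E, c)`,
`N = 3`) derives `s(z) = s(2 − z)` on the `(χ₁, χ₂)`-pair-sections with right `(K′, ω)`-law of a SELF-DUAL pair (`χ₁ʷ = χ₁`) from three letters at a base point `g`: the Fubini
integrability `hint` of `(y, v) ↦ h(y)·f_w^φ(w₀ v g y)` on `ν_G ⊗ ν` for `Re w > 2`, the continuity `hcontM` of `w ↦ M(w)φ(g)` on `{Re w > 2}`, and the non-vanishing `hMne`.  The first two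
are ANALYSIS and hold for every `g` on the Heisenberg radical of `U(J₃)` (`2ρ_B = 2`):
* `hint`: ★ CMTwo §1 `integrable_mul_flatSectionU_prod_of_scaling` (EVERY RANK, by name) with `ρ₀ = 2`, the scaling identity `∫_N H(w₀ v x)^w dν = c(w)·H(x)^{2−w}` (★ CMThree
  `integral_borelHeight_weylLongU_mul_cpow_eq` over Iwasawa ★ `exists_mem_borelAdelic_mul_mem_standardMaximalCompactGL_cm_three`) and the fibre integrability `v ↦ H(w₀ v x)^σ ∈ L¹(ν)`
  for `σ > 2` (★ `integrable_borelHeight_weylLongU_mul_rpow_cm_three`, radical package `(ν, 𝓕)` ★-inhabited by `K2E1SphericalEisensteinStructuralDataCMThree.exists_unipotent_haar_fundamentalDomain_cm`);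
* `hcontM`: ★ `continuousOn_intertwiningIntegral_flatSectionU` (every rank, dominated convergence, bounded measurable `φ`) at `σ₀ = 2` over the same fibre integrability.
§1 then re-issues ★ FILE 1's two heads at the CM pair with ONLY the non-vanishing letter left, base-point-free: `hMne : ∃ g w₁, 2 < Re w₁ ∧ M(w₁)φ(g) ≠ 0` — payer: injectivity of
`M(w₁)` from the matrix functional equation of the `U(2,1)` χ-pair Eisenstein family (row 7b-2 ∕ row 8 consumers feed it).
* §1 **`integrable_mul_flatSectionU_prod_cm_three`** (`hint`, every `g`, every `Re w > 2`), **`continuousOn_intertwining_flatSectionU_cm_three`** (`hcontM`, every `g`), HEADS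
  **`chi_symbol_symm_of_selfDual_cm_three`** (`∀ z, s z = s (2 − z)`) and **`chi_symbol_hsymm_of_selfDual_cm_three`** (`∀ t, s(1 − it) = s(1 + it)`) in the PAIR currency.
* §2 the same two heads in the single-character currency `φ ∈ chiSectionSpace χ K′ ω` (`χ₂ = 1`, ★ `isChiSectionPair_iff_isChiSection_of_trivial`):
  **`chi_symbol_symm_of_selfDual_cm_three_of_mem`**, **`chi_symbol_hsymm_of_selfDual_cm_three_of_mem`** — ★ CMTwo's binders token for token (row 7b-2's import).
HONEST LABEL: HC_CM is proved only modulo the 7 printed citations (2 remaining named inputs: hLiu418 = `stmt-HodgeConjecture-24832`, h413 = `stmt-HodgeConjecture-24833`) until rung 0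
closes; this file asserts no named fact, is conditional by construction on the visible letter `hMne`, and closes no socket; count-neutral.

## References
* [MoeglinWaldspurger1995] C. Mœglin, J.-L. Waldspurger, *Spectral decomposition and Eisenstein series* (1995): II.1.6–II.1.7, IV.1.10.
* [Garrett2018] P. Garrett, *Modern Analysis of Automorphic Forms by Example* (2018): §2.8.
* [Rogawski1990] J. D. Rogawski, *Automorphic Representations of Unitary Groups in Three Variables* (1990): §13.9 p. 229.
-/

set_option autoImplicit false
set_option linter.dupNamespace false -- the mandated namespace repeats `HodgeConjecture.HodgeConjecture`

noncomputable section

open MeasureTheory Measure NumberField Filter Topology Set Function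
open scoped NNReal ENNReal
open Literature.NumberTheory Literature.NumberTheory.Automorphic Literature.NumberTheory.Automorphic.UnitaryGroup AdelicGroupData
open Literature.NumberTheory.GaloisRepresentations (HeckeCharacter)
open Literature.NumberTheory.Automorphic.Arthur2013.Leaves.TECR
open Summit.HodgeConjecture.HodgeConjecture.Cruxes.H413.K2E1BorelEisensteinU
open Summit.HodgeConjecture.HodgeConjecture.Cruxes.H413.K2E1CharacterEisensteinU2Defs
open Summit.HodgeConjecture.HodgeConjecture.Cruxes.H413.K2E1CharacterEisensteinU3PairDefs
open Summit.HodgeConjecture.HodgeConjecture.Cruxes.H413.K2E1IntertwinedCoeffContinuousCMTwo (continuousOn_intertwiningIntegral_flatSectionU)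
open Summit.HodgeConjecture.HodgeConjecture.Cruxes.H413.K2E1IntertwinedCoeffContinuousCM (integrable_borelHeight_weylLongU_mul_rpow_cm_three)
open Summit.HodgeConjecture.HodgeConjecture.Cruxes.H413.K2E1HeisenbergHaarU3 (locallyCompactSpace_and_secondCountableTopology_adelicUnipotent)
open Summit.HodgeConjecture.HodgeConjecture.Cruxes.H413.K2E1ChiSymbolWeylSymmetrySelfDualCMTwo (integrable_mul_flatSectionU_prod_of_scaling)
open Summit.HodgeConjecture.HodgeConjecture.Cruxes.H413.K2E1ChiSymbolWeylSymmetrySelfDualU3 (chi_symbol_symm_of_selfDual_three)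
open Summit.HodgeConjecture.HodgeConjecture.Cruxes.H413.K2E1ChiSectionSpaceU2Defs

namespace Summit.HodgeConjecture.HodgeConjecture.Cruxes.H413.K2E1ChiSymbolWeylSymmetrySelfDualCMThree

variable (L : Type) [Field L] [NumberField L] [IsCMField L]
  [MeasurableSpace (quasiSplit (↥(maximalRealSubfield L)) L (IsCMField.complexConj L) 3).Adelic] [BorelSpace (quasiSplit (↥(maximalRealSubfield L)) L (IsCMField.complexConj L) 3).Adelic]

/-! ## §1 `U(2,1)_{L∕L⁺}`: `hint` and `hcontM` discharged on `{Re w > 2}` over the radical package; the heads modulo `hMne` -/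

/-- **`hint` AT THE CM PAIR `U(2,1)_{L∕L⁺}`, EVERY BASE POINT, EVERY `Re w > 2`**: for a Haar measure `ν_G` of `G(𝔸)`, an inversion-invariant Haar measure `ν` of `N(𝔸)` with a fundamental
domain `𝓕` of `N(L⁺)` of compact closure, `h ∈ C_c(G(𝔸))`, `φ` measurable bounded: `(y, v) ↦ h(y)·f_w^φ(w₀ v · g y) ∈ L¹(ν_G ⊗ ν)` — ★ CMTwo §1 (every rank) with `ρ₀ = 2`, `hscale` ★
CMThree `integral_borelHeight_weylLongU_mul_cpow_eq` (Iwasawa ★ `exists_mem_borelAdelic_mul_mem_standardMaximalCompactGL_cm_three`) and `hintw` ★ `integrable_borelHeight_weylLongU_mul_rpow_cm_three`.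
[cite: MoeglinWaldspurger1995, II.1.6–II.1.7] [cite: Garrett2018, §2.8] -/
theorem integrable_mul_flatSectionU_prod_cm_three (νG : Measure (quasiSplit (↥(maximalRealSubfield L)) L (IsCMField.complexConj L) 3).Adelic) [νG.IsHaarMeasure]
    (ν : Measure ↥(adelicUnipotent (↥(maximalRealSubfield L)) L (IsCMField.complexConj L) 3)) [ν.IsHaarMeasure] [ν.IsInvInvariant]
    {𝓕 : Set ↥(adelicUnipotent (↥(maximalRealSubfield L)) L (IsCMField.complexConj L) 3)}
    (h𝓕N : IsFundamentalDomain ↥(rationalUnipotent (↥(maximalRealSubfield L)) L (IsCMField.complexConj L) 3) 𝓕 ν) (h𝓕c : IsCompact (closure 𝓕))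
    {h : (quasiSplit (↥(maximalRealSubfield L)) L (IsCMField.complexConj L) 3).Adelic → ℂ} (hh : Continuous h) (hhs : HasCompactSupport h)
    {φ : (quasiSplit (↥(maximalRealSubfield L)) L (IsCMField.complexConj L) 3).Adelic → ℂ} (hφm : Measurable φ) {Cφ : ℝ} (hφC : ∀ x, ‖φ x‖ ≤ Cφ)
    (g : (quasiSplit (↥(maximalRealSubfield L)) L (IsCMField.complexConj L) 3).Adelic) {w : ℂ} (hw : 2 < w.re) :
    Integrable (uncurry fun (y : (quasiSplit (↥(maximalRealSubfield L)) L (IsCMField.complexConj L) 3).Adelic) (v : ↥(adelicUnipotent (↥(maximalRealSubfield L)) L (IsCMField.complexConj L) 3)) =>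
      h y * flatSectionU φ w ((quasiSplit (↥(maximalRealSubfield L)) L (IsCMField.complexConj L) 3).toAdelic (weylLongU ((IsCMField.complexConj L : L ≃ₐ[↥(maximalRealSubfield L)] L) : L →+* L) (rfl : (StdForm.antidiagonal 3).over L = (StdForm.antidiagonal 3).over L)) *
        (v : (quasiSplit (↥(maximalRealSubfield L)) L (IsCMField.complexConj L) 3).Adelic) * (g * y))) (νG.prod ν) := by
  have hc : IsCMField.complexConj L * IsCMField.complexConj L = 1 := AlgEquiv.ext fun x => IsCMField.complexConj_apply_apply L x
  have hc1 : IsCMField.complexConj L ≠ 1 := IsCMField.complexConj_ne_one L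
  haveI := t2Space_adeleRing_of_numberField L
  haveI := locallyCompactSpace_adeleRing' L
  haveI := secondCountableTopology_adeleRing L
  haveI : SecondCountableTopology (quasiSplit (↥(maximalRealSubfield L)) L (IsCMField.complexConj L) 3).Adelic :=
    inferInstanceAs (SecondCountableTopology (adelic (↥(maximalRealSubfield L)) L (IsCMField.complexConj L) 3 ((StdForm.antidiagonal 3).over L)))
  haveI : LocallyCompactSpace (quasiSplit (↥(maximalRealSubfield L)) L (IsCMField.complexConj L) 3).Adelic :=
    inferInstanceAs (LocallyCompactSpace (adelic (↥(maximalRealSubfield L)) L (IsCMField.complexConj L) 3 ((StdForm.antidiagonal 3).over L)))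
  obtain ⟨h₁, h₂⟩ := locallyCompactSpace_and_secondCountableTopology_adelicUnipotent (F := ↥(maximalRealSubfield L)) (E := L) (c := IsCMField.complexConj L) (N := 3)
  haveI := h₁
  haveI := h₂
  have hBK := exists_mem_borelAdelic_mul_mem_standardMaximalCompactGL_cm_three L
  have hscale := K2E1MaassSelbergSphericalBracketsCMThree.integral_borelHeight_weylLongU_mul_cpow_eq hc hc1 ν hBK
  exact integrable_mul_flatSectionU_prod_of_scaling νG ν (ρ₀ := 2) (fun w g => by rw [show ((2 : ℝ) : ℂ) = 2 by norm_num]; exact hscale w g) hh hhs hφm hφC g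
    fun x => integrable_borelHeight_weylLongU_mul_rpow_cm_three L ν h𝓕N h𝓕c hw x

/-- **`hcontM` AT THE CM PAIR `U(2,1)_{L∕L⁺}`, EVERY BASE POINT**: `w ↦ ∫_N f_w^φ(w₀ v g) dν` is continuous on `{Re w > 2}` for `φ` measurable bounded — ★ `continuousOn_intertwiningIntegral_flatSectionU`
(every rank, dominated convergence) at `σ₀ = 2` over ★ `integrable_borelHeight_weylLongU_mul_rpow_cm_three`. [cite: MoeglinWaldspurger1995, II.1.6–II.1.7] [cite: Garrett2018, §2.8] -/
theorem continuousOn_intertwining_flatSectionU_cm_three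
    (ν : Measure ↥(adelicUnipotent (↥(maximalRealSubfield L)) L (IsCMField.complexConj L) 3)) [ν.IsHaarMeasure] [ν.IsInvInvariant]
    {𝓕 : Set ↥(adelicUnipotent (↥(maximalRealSubfield L)) L (IsCMField.complexConj L) 3)}
    (h𝓕N : IsFundamentalDomain ↥(rationalUnipotent (↥(maximalRealSubfield L)) L (IsCMField.complexConj L) 3) 𝓕 ν) (h𝓕c : IsCompact (closure 𝓕))
    {φ : (quasiSplit (↥(maximalRealSubfield L)) L (IsCMField.complexConj L) 3).Adelic → ℂ} (hφm : Measurable φ) {Cφ : ℝ} (hφC : ∀ x, ‖φ x‖ ≤ Cφ)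
    (g : (quasiSplit (↥(maximalRealSubfield L)) L (IsCMField.complexConj L) 3).Adelic) :
    ContinuousOn (fun w : ℂ => ∫ v : ↥(adelicUnipotent (↥(maximalRealSubfield L)) L (IsCMField.complexConj L) 3), flatSectionU φ w
      ((quasiSplit (↥(maximalRealSubfield L)) L (IsCMField.complexConj L) 3).toAdelic (weylLongU ((IsCMField.complexConj L : L ≃ₐ[↥(maximalRealSubfield L)] L) : L →+* L) (rfl : (StdForm.antidiagonal 3).over L = (StdForm.antidiagonal 3).over L)) *
        ((v : (quasiSplit (↥(maximalRealSubfield L)) L (IsCMField.complexConj L) 3).Adelic) * g)) ∂ν) {w : ℂ | 2 < w.re} :=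
  continuousOn_intertwiningIntegral_flatSectionU ν hφm hφC g (σ₀ := 2) fun _ hσ => integrable_borelHeight_weylLongU_mul_rpow_cm_three L ν h𝓕N h𝓕c hσ g

/-- **`s(z) = s(2 − z)` FOR A SELF-DUAL PAIR ON `U(2,1)_{L∕L⁺}` MODULO `hMne`**: binders — a Haar measure `ν_G`; the radical package `(ν, 𝓕)` (★-inhabited); `χ₁` self-dual
(`reflectChar c χ₁ = χ₁`), `χ₂` any continuous `U(1)`-torus character; `K′ ≤ K_U`; `φ` a measurable bounded `(χ₁, χ₂)`-pair-section with right `(K′, ω)`-law; `h ∈ C_c(G(𝔸))` with entire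
symbol `s` and symbol law `hR` on all such sections; and THE ONE LETTER `hMne : ∃ g w₁, 2 < Re w₁ ∧ ∫_N f_{w₁}^φ(w₀ v g) dν ≠ 0`.  THEN `∀ z, s z = s (2 − z)` — ★ FILE 1
`chi_symbol_symm_of_selfDual_three` at the base point `g` of `hMne`, with `hint` and `hcontM` (§1) discharged. [cite: MoeglinWaldspurger1995, IV.1.10] [cite: Garrett2018, §2.8] -/
theorem chi_symbol_symm_of_selfDual_cm_three (νG : Measure (quasiSplit (↥(maximalRealSubfield L)) L (IsCMField.complexConj L) 3).Adelic) [νG.IsHaarMeasure]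
    (ν : Measure ↥(adelicUnipotent (↥(maximalRealSubfield L)) L (IsCMField.complexConj L) 3)) [ν.IsHaarMeasure] [ν.IsInvInvariant]
    {𝓕 : Set ↥(adelicUnipotent (↥(maximalRealSubfield L)) L (IsCMField.complexConj L) 3)}
    (h𝓕N : IsFundamentalDomain ↥(rationalUnipotent (↥(maximalRealSubfield L)) L (IsCMField.complexConj L) 3) 𝓕 ν) (h𝓕c : IsCompact (closure 𝓕))
    {χ₁ : HeckeCharacter L} {χ₂ : ↥(TorusDict.torus (IsCMField.complexConj L)) →ₜ* ℂˣ} (hsd : reflectChar (IsCMField.complexConj L) χ₁ = χ₁)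
    {K' : Subgroup (quasiSplit (↥(maximalRealSubfield L)) L (IsCMField.complexConj L) 3).Adelic} {ω : ↥K' → ℂ}
    (hK'U : K' ≤ ((standardMaximalCompactGL 3 L).comap (adelicVal (↥(maximalRealSubfield L)) L (IsCMField.complexConj L) 3 ((StdForm.antidiagonal 3).over L)) : Subgroup (quasiSplit (↥(maximalRealSubfield L)) L (IsCMField.complexConj L) 3).Adelic))
    {φ : (quasiSplit (↥(maximalRealSubfield L)) L (IsCMField.complexConj L) 3).Adelic → ℂ} (hφ : IsChiSectionPair χ₁ χ₂ φ)
    (hφK : ∀ (g : (quasiSplit (↥(maximalRealSubfield L)) L (IsCMField.complexConj L) 3).Adelic) (k : ↥K'), φ (g * k) = ω k * φ g) (hφm : Measurable φ) {Cφ : ℝ} (hφC : ∀ x, ‖φ x‖ ≤ Cφ)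
    {h : (quasiSplit (↥(maximalRealSubfield L)) L (IsCMField.complexConj L) 3).Adelic → ℂ} (hh : Continuous h) (hhs : HasCompactSupport h) (s : ℂ → ℂ) (hs : Differentiable ℂ s)
    (hR : ∀ (z : ℂ) (ψ : (quasiSplit (↥(maximalRealSubfield L)) L (IsCMField.complexConj L) 3).Adelic → ℂ), IsChiSectionPair χ₁ χ₂ ψ →
      (∀ (g : (quasiSplit (↥(maximalRealSubfield L)) L (IsCMField.complexConj L) 3).Adelic) (k : ↥K'), ψ (g * k) = ω k * ψ g) →
      ∀ x : (quasiSplit (↥(maximalRealSubfield L)) L (IsCMField.complexConj L) 3).Adelic, ∫ y, h y * flatSectionU ψ z (x * y) ∂νG = s z * flatSectionU ψ z x)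
    (hMne : ∃ (g : (quasiSplit (↥(maximalRealSubfield L)) L (IsCMField.complexConj L) 3).Adelic) (w₁ : ℂ), 2 < w₁.re ∧
      ∫ v : ↥(adelicUnipotent (↥(maximalRealSubfield L)) L (IsCMField.complexConj L) 3), flatSectionU φ w₁
        ((quasiSplit (↥(maximalRealSubfield L)) L (IsCMField.complexConj L) 3).toAdelic (weylLongU ((IsCMField.complexConj L : L ≃ₐ[↥(maximalRealSubfield L)] L) : L →+* L) (rfl : (StdForm.antidiagonal 3).over L = (StdForm.antidiagonal 3).over L)) *
          ((v : (quasiSplit (↥(maximalRealSubfield L)) L (IsCMField.complexConj L) 3).Adelic) * g)) ∂ν ≠ 0)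
    (z : ℂ) : s z = s (2 - z) := by
  have hc : IsCMField.complexConj L * IsCMField.complexConj L = 1 := AlgEquiv.ext fun x => IsCMField.complexConj_apply_apply L x
  have hc1 : IsCMField.complexConj L ≠ 1 := IsCMField.complexConj_ne_one L
  haveI := t2Space_adeleRing_of_numberField L
  haveI := locallyCompactSpace_adeleRing' L
  haveI := secondCountableTopology_adeleRing L
  haveI : SecondCountableTopology (quasiSplit (↥(maximalRealSubfield L)) L (IsCMField.complexConj L) 3).Adelic :=
    inferInstanceAs (SecondCountableTopology (adelic (↥(maximalRealSubfield L)) L (IsCMField.complexConj L) 3 ((StdForm.antidiagonal 3).over L)))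
  haveI : LocallyCompactSpace (quasiSplit (↥(maximalRealSubfield L)) L (IsCMField.complexConj L) 3).Adelic :=
    inferInstanceAs (LocallyCompactSpace (adelic (↥(maximalRealSubfield L)) L (IsCMField.complexConj L) 3 ((StdForm.antidiagonal 3).over L)))
  obtain ⟨h₁, h₂⟩ := locallyCompactSpace_and_secondCountableTopology_adelicUnipotent (F := ↥(maximalRealSubfield L)) (E := L) (c := IsCMField.complexConj L) (N := 3)
  haveI := h₁
  haveI := h₂
  obtain ⟨g, w₁, hw₁, hne⟩ := hMne
  exact chi_symbol_symm_of_selfDual_three hc hc1 νG ν hsd hK'U hφ hφK hφm h s hs hR g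
    (fun w hw => integrable_mul_flatSectionU_prod_cm_three L νG ν h𝓕N h𝓕c hh hhs hφm hφC g hw)
    (continuousOn_intertwining_flatSectionU_cm_three L ν h𝓕N h𝓕c hφm hφC g) ⟨w₁, hw₁, hne⟩ z

/-- **`hsymm` FOR A SELF-DUAL PAIR ON `U(2,1)_{L∕L⁺}` MODULO `hMne`** — the N = 3 byte shape `∀ t, s(1 − it) = s(1 + it)` (centre `z = 1`), `hint`∕`hcontM` discharged.
[cite: MoeglinWaldspurger1995, IV.1.10] [cite: Garrett2018, §2.8] -/
theorem chi_symbol_hsymm_of_selfDual_cm_three (νG : Measure (quasiSplit (↥(maximalRealSubfield L)) L (IsCMField.complexConj L) 3).Adelic) [νG.IsHaarMeasure]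
    (ν : Measure ↥(adelicUnipotent (↥(maximalRealSubfield L)) L (IsCMField.complexConj L) 3)) [ν.IsHaarMeasure] [ν.IsInvInvariant]
    {𝓕 : Set ↥(adelicUnipotent (↥(maximalRealSubfield L)) L (IsCMField.complexConj L) 3)}
    (h𝓕N : IsFundamentalDomain ↥(rationalUnipotent (↥(maximalRealSubfield L)) L (IsCMField.complexConj L) 3) 𝓕 ν) (h𝓕c : IsCompact (closure 𝓕))
    {χ₁ : HeckeCharacter L} {χ₂ : ↥(TorusDict.torus (IsCMField.complexConj L)) →ₜ* ℂˣ} (hsd : reflectChar (IsCMField.complexConj L) χ₁ = χ₁)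
    {K' : Subgroup (quasiSplit (↥(maximalRealSubfield L)) L (IsCMField.complexConj L) 3).Adelic} {ω : ↥K' → ℂ}
    (hK'U : K' ≤ ((standardMaximalCompactGL 3 L).comap (adelicVal (↥(maximalRealSubfield L)) L (IsCMField.complexConj L) 3 ((StdForm.antidiagonal 3).over L)) : Subgroup (quasiSplit (↥(maximalRealSubfield L)) L (IsCMField.complexConj L) 3).Adelic))
    {φ : (quasiSplit (↥(maximalRealSubfield L)) L (IsCMField.complexConj L) 3).Adelic → ℂ} (hφ : IsChiSectionPair χ₁ χ₂ φ)
    (hφK : ∀ (g : (quasiSplit (↥(maximalRealSubfield L)) L (IsCMField.complexConj L) 3).Adelic) (k : ↥K'), φ (g * k) = ω k * φ g) (hφm : Measurable φ) {Cφ : ℝ} (hφC : ∀ x, ‖φ x‖ ≤ Cφ)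
    {h : (quasiSplit (↥(maximalRealSubfield L)) L (IsCMField.complexConj L) 3).Adelic → ℂ} (hh : Continuous h) (hhs : HasCompactSupport h) (s : ℂ → ℂ) (hs : Differentiable ℂ s)
    (hR : ∀ (z : ℂ) (ψ : (quasiSplit (↥(maximalRealSubfield L)) L (IsCMField.complexConj L) 3).Adelic → ℂ), IsChiSectionPair χ₁ χ₂ ψ →
      (∀ (g : (quasiSplit (↥(maximalRealSubfield L)) L (IsCMField.complexConj L) 3).Adelic) (k : ↥K'), ψ (g * k) = ω k * ψ g) →
      ∀ x : (quasiSplit (↥(maximalRealSubfield L)) L (IsCMField.complexConj L) 3).Adelic, ∫ y, h y * flatSectionU ψ z (x * y) ∂νG = s z * flatSectionU ψ z x)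
    (hMne : ∃ (g : (quasiSplit (↥(maximalRealSubfield L)) L (IsCMField.complexConj L) 3).Adelic) (w₁ : ℂ), 2 < w₁.re ∧
      ∫ v : ↥(adelicUnipotent (↥(maximalRealSubfield L)) L (IsCMField.complexConj L) 3), flatSectionU φ w₁
        ((quasiSplit (↥(maximalRealSubfield L)) L (IsCMField.complexConj L) 3).toAdelic (weylLongU ((IsCMField.complexConj L : L ≃ₐ[↥(maximalRealSubfield L)] L) : L →+* L) (rfl : (StdForm.antidiagonal 3).over L = (StdForm.antidiagonal 3).over L)) *
          ((v : (quasiSplit (↥(maximalRealSubfield L)) L (IsCMField.complexConj L) 3).Adelic) * g)) ∂ν ≠ 0)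
    (t : ℝ) : s (1 - t * Complex.I) = s (1 + t * Complex.I) := by
  have h1 := chi_symbol_symm_of_selfDual_cm_three L νG ν h𝓕N h𝓕c hsd hK'U hφ hφK hφm hφC hh hhs s hs hR hMne (1 + t * Complex.I)
  rw [h1]
  congr 1
  ring

/-! ## §2 The single-character currency `V(χ, K′, ω) = chiSectionSpace χ K′ ω` (`χ₂ = 1`): the heads row 7b-2 consumes verbatim -/

/-- **`s(z) = s(2 − z)` ON `V(χ, K′, ω)` (`U(2,1)_{L∕L⁺}`, SELF-DUAL `χ`, `χ₂ = 1`) MODULO `hMne`** — the N = 3 twin of ★ `chi_symbol_symm_of_selfDual_cm_two` BINDER FOR BINDER (`φ ∈ chiSectionSpace χ K′ ω`,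
`hR` on `chiSectionSpace χ K′ ω` — the rank-generic ★ `K2E1ChiSectionSpaceU2Defs.chiSectionSpace`, as in ★ row 7b-1 `hfam_gauge_cm_three`): §1 at the trivial torus character
`χ₂ := 1` through ★ `isChiSectionPair_iff_isChiSection_of_trivial`. [cite: MoeglinWaldspurger1995, IV.1.10] [cite: Garrett2018, §2.8] -/
theorem chi_symbol_symm_of_selfDual_cm_three_of_mem (νG : Measure (quasiSplit (↥(maximalRealSubfield L)) L (IsCMField.complexConj L) 3).Adelic) [νG.IsHaarMeasure]
    (ν : Measure ↥(adelicUnipotent (↥(maximalRealSubfield L)) L (IsCMField.complexConj L) 3)) [ν.IsHaarMeasure] [ν.IsInvInvariant]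
    {𝓕 : Set ↥(adelicUnipotent (↥(maximalRealSubfield L)) L (IsCMField.complexConj L) 3)}
    (h𝓕N : IsFundamentalDomain ↥(rationalUnipotent (↥(maximalRealSubfield L)) L (IsCMField.complexConj L) 3) 𝓕 ν) (h𝓕c : IsCompact (closure 𝓕))
    {χ : HeckeCharacter L} (hsd : reflectChar (IsCMField.complexConj L) χ = χ)
    {K' : Subgroup (quasiSplit (↥(maximalRealSubfield L)) L (IsCMField.complexConj L) 3).Adelic} {ω : ↥K' → ℂ}
    (hK'U : K' ≤ ((standardMaximalCompactGL 3 L).comap (adelicVal (↥(maximalRealSubfield L)) L (IsCMField.complexConj L) 3 ((StdForm.antidiagonal 3).over L)) : Subgroup (quasiSplit (↥(maximalRealSubfield L)) L (IsCMField.complexConj L) 3).Adelic))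
    {φ : (quasiSplit (↥(maximalRealSubfield L)) L (IsCMField.complexConj L) 3).Adelic → ℂ} (hφ : φ ∈ chiSectionSpace χ K' ω) (hφm : Measurable φ) {Cφ : ℝ} (hφC : ∀ x, ‖φ x‖ ≤ Cφ)
    {h : (quasiSplit (↥(maximalRealSubfield L)) L (IsCMField.complexConj L) 3).Adelic → ℂ} (hh : Continuous h) (hhs : HasCompactSupport h) (s : ℂ → ℂ) (hs : Differentiable ℂ s)
    (hR : ∀ (z : ℂ), ∀ ψ ∈ chiSectionSpace χ K' ω, ∀ x : (quasiSplit (↥(maximalRealSubfield L)) L (IsCMField.complexConj L) 3).Adelic,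
      ∫ y, h y * flatSectionU ψ z (x * y) ∂νG = s z * flatSectionU ψ z x)
    (hMne : ∃ (g : (quasiSplit (↥(maximalRealSubfield L)) L (IsCMField.complexConj L) 3).Adelic) (w₁ : ℂ), 2 < w₁.re ∧
      ∫ v : ↥(adelicUnipotent (↥(maximalRealSubfield L)) L (IsCMField.complexConj L) 3), flatSectionU φ w₁
        ((quasiSplit (↥(maximalRealSubfield L)) L (IsCMField.complexConj L) 3).toAdelic (weylLongU ((IsCMField.complexConj L : L ≃ₐ[↥(maximalRealSubfield L)] L) : L →+* L) (rfl : (StdForm.antidiagonal 3).over L = (StdForm.antidiagonal 3).over L)) *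
          ((v : (quasiSplit (↥(maximalRealSubfield L)) L (IsCMField.complexConj L) 3).Adelic) * g)) ∂ν ≠ 0)
    (z : ℂ) : s z = s (2 - z) := by
  have h1 : ∀ t : ↥(TorusDict.torus (IsCMField.complexConj L)), (1 : ↥(TorusDict.torus (IsCMField.complexConj L)) →ₜ* ℂˣ) t = 1 := fun t => by
    rw [ContinuousMonoidHom.coe_one, Pi.one_apply]
  have hφ' : IsChiSectionPair χ (1 : ↥(TorusDict.torus (IsCMField.complexConj L)) →ₜ* ℂˣ) φ := (isChiSectionPair_iff_isChiSection_of_trivial h1).2 (isChiSection_of_mem hφ)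
  exact chi_symbol_symm_of_selfDual_cm_three L νG ν h𝓕N h𝓕c hsd hK'U hφ' (fun g k => apply_mul_of_mem hφ g k) hφm hφC hh hhs s hs
    (fun z ψ hψ hψK x => hR z ψ ((mem_chiSectionSpace_iff ψ).2 ⟨(isChiSectionPair_iff_isChiSection_of_trivial h1).1 hψ, hψK⟩) x) hMne z

/-- **`hsymm` ON `V(χ, K′, ω)` (`U(2,1)_{L∕L⁺}`, SELF-DUAL `χ`, `χ₂ = 1`) MODULO `hMne`**: `∀ t, s(1 − it) = s(1 + it)` — the N = 3 twin of ★ `chi_symbol_hsymm_of_selfDual_cm_two` binder for binder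
(`½ ↦ 1`, `1 < ↦ 2 <`); the import of row 7b-2 `K2E1ChiConvDataLevelCMThree`. [cite: MoeglinWaldspurger1995, IV.1.10] [cite: Garrett2018, §2.8] -/
theorem chi_symbol_hsymm_of_selfDual_cm_three_of_mem (νG : Measure (quasiSplit (↥(maximalRealSubfield L)) L (IsCMField.complexConj L) 3).Adelic) [νG.IsHaarMeasure]
    (ν : Measure ↥(adelicUnipotent (↥(maximalRealSubfield L)) L (IsCMField.complexConj L) 3)) [ν.IsHaarMeasure] [ν.IsInvInvariant]
    {𝓕 : Set ↥(adelicUnipotent (↥(maximalRealSubfield L)) L (IsCMField.complexConj L) 3)}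
    (h𝓕N : IsFundamentalDomain ↥(rationalUnipotent (↥(maximalRealSubfield L)) L (IsCMField.complexConj L) 3) 𝓕 ν) (h𝓕c : IsCompact (closure 𝓕))
    {χ : HeckeCharacter L} (hsd : reflectChar (IsCMField.complexConj L) χ = χ)
    {K' : Subgroup (quasiSplit (↥(maximalRealSubfield L)) L (IsCMField.complexConj L) 3).Adelic} {ω : ↥K' → ℂ}
    (hK'U : K' ≤ ((standardMaximalCompactGL 3 L).comap (adelicVal (↥(maximalRealSubfield L)) L (IsCMField.complexConj L) 3 ((StdForm.antidiagonal 3).over L)) : Subgroup (quasiSplit (↥(maximalRealSubfield L)) L (IsCMField.complexConj L) 3).Adelic))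
    {φ : (quasiSplit (↥(maximalRealSubfield L)) L (IsCMField.complexConj L) 3).Adelic → ℂ} (hφ : φ ∈ chiSectionSpace χ K' ω) (hφm : Measurable φ) {Cφ : ℝ} (hφC : ∀ x, ‖φ x‖ ≤ Cφ)
    {h : (quasiSplit (↥(maximalRealSubfield L)) L (IsCMField.complexConj L) 3).Adelic → ℂ} (hh : Continuous h) (hhs : HasCompactSupport h) (s : ℂ → ℂ) (hs : Differentiable ℂ s)
    (hR : ∀ (z : ℂ), ∀ ψ ∈ chiSectionSpace χ K' ω, ∀ x : (quasiSplit (↥(maximalRealSubfield L)) L (IsCMField.complexConj L) 3).Adelic,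
      ∫ y, h y * flatSectionU ψ z (x * y) ∂νG = s z * flatSectionU ψ z x)
    (hMne : ∃ (g : (quasiSplit (↥(maximalRealSubfield L)) L (IsCMField.complexConj L) 3).Adelic) (w₁ : ℂ), 2 < w₁.re ∧
      ∫ v : ↥(adelicUnipotent (↥(maximalRealSubfield L)) L (IsCMField.complexConj L) 3), flatSectionU φ w₁
        ((quasiSplit (↥(maximalRealSubfield L)) L (IsCMField.complexConj L) 3).toAdelic (weylLongU ((IsCMField.complexConj L : L ≃ₐ[↥(maximalRealSubfield L)] L) : L →+* L) (rfl : (StdForm.antidiagonal 3).over L = (StdForm.antidiagonal 3).over L)) *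
          ((v : (quasiSplit (↥(maximalRealSubfield L)) L (IsCMField.complexConj L) 3).Adelic) * g)) ∂ν ≠ 0)
    (t : ℝ) : s (1 - t * Complex.I) = s (1 + t * Complex.I) := by
  have h1 := chi_symbol_symm_of_selfDual_cm_three_of_mem L νG ν h𝓕N h𝓕c hsd hK'U hφ hφm hφC hh hhs s hs hR hMne (1 + t * Complex.I)
  rw [h1]
  congr 1
  ring

end Summit.HodgeConjecture.HodgeConjecture.Cruxes.H413.K2E1ChiSymbolWeylSymmetrySelfDualCMThree

end
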